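import Literature.NumberTheory.LFunctions.AutomaticSequenceTransducerGroup
import HarnessLib

/-!
# Relabelling the naturally induced transducer: Lemma 2.14, Prop. 2.15 and Thm. 2.7 (1) of Müllner 2017 (proved)

Everything in this file is PROVED (plus plain definitions). Müllner (Prop. 2.6) may reorder the
tuples `q ∈ Q` of the naturally induced transducer by permutations `σ_q`; the outputs change by
`T̄(q̄, w) = σ_q ∘ T(q, w) ∘ σ_{δ(q,w)}⁻¹`. For the transducer `MinImage δ`
(`AutomaticSequenceTransducer.lean`, enumerations `MinImage.enum` chosen arbitrarily) we formalise
this freedom as a RELABELLING `ρ : MinImage δ → Perm (Fin n₀)` (new enumeration `enum_M ≫ ρ_M`):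

* `MinImage.Tρ ρ M w = ρ_M⁻¹ ≫ T(M, w) ≫ ρ_{δ(M,w)}` — the relabelled outputs; multiplicative
  (`Tρ_append`), reconstruct the automaton (`wordAct_eq_ρ`), and their path sets are the conjugates
  of the old ones (`mem_pathOutputsρ_iff`);
* **Lemma 2.14** (`MinImage.goodLabel M₀`, `one_mem_pathOutputsρ_goodLabel`): the choice
  `ρ_M ∈ G_{M M₀}(0)` (`ρ_{M₀} = 1`) makes `id ∈ Ḡ_{M₀ M}(0)` for every `M`;
* **Prop. 2.15 (class `0`)** (`pathOutputsρ_zero_eq`): for such a relabelling all `Ḡ_{M M'}(0)`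
  coincide with the group `Ḡ = Ḡ_{M₀M₀}(0)` (`MinImage.loopGroupρ`);
* **Thm. 2.7 (1)** (`Tρ_mem_loopGroupρ`): `T̄(M, w) ∈ Ḡ` for every state `M` and every word of
  length divisible by `d(A)` — in particular for EVERY word when `d(A) = 1`
  (`Tρ_mem_loopGroupρ_of_period_eq_one`), the situation of §4 after Prop. 2.25.

The cosets `Ḡ · g₀^ℓ` for `ℓ ≢ 0 (mod d)` (the rest of Prop. 2.15) are not formalised (after
Prop. 2.25 one has `d = 1`).

## References
* C. Müllner, Duke Math. J. 166 (2017), Prop. 2.6, Lemma 2.14, Prop. 2.15, Thm. 2.7. [Mullner2017]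
-/

noncomputable section

open Finset

namespace Literature.NumberTheory.LFunctions

namespace MinImage

variable {σ : Type*} [Fintype σ] [DecidableEq σ] {δ : σ → ℕ → σ} {k : ℕ}

/-! ## Relabelled outputs -/

/-- The outputs of the transducer after relabelling the enumerations by `ρ`
(`enum_M ↦ enum_M ≫ ρ_M`): `T̄(M, w) = ρ_M⁻¹ ≫ T(M, w) ≫ ρ_{δ(M,w)}` (Müllner, Prop. 2.6:
`T̄(q̄, w) = σ_q ∘ T(q, w) ∘ σ_{δ(q,w)}⁻¹`). [cite: Mullner2017, Prop. 2.6] -/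
def Tρ (ρ : MinImage δ → Equiv.Perm (Fin (minRank δ))) (M : MinImage δ) (w : List ℕ) :
    Equiv.Perm (Fin (minRank δ)) :=
  ((ρ M).symm.trans (M.T w)).trans (ρ (M.next w))

/-- Relabellings of equal states agree. [folklore] -/
theorem rho_congr (ρ : MinImage δ → Equiv.Perm (Fin (minRank δ))) {M M' : MinImage δ}
    (h : M = M') : ρ M = ρ M' := by rw [h]

/-- **Multiplicativity of the relabelled outputs**: `T̄(M, v w) = T̄(M, v) ≫ T̄(δ(M,v), w)`.
[cite: Mullner2017, Prop. 2.6] -/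
theorem Tρ_append (ρ : MinImage δ → Equiv.Perm (Fin (minRank δ))) (M : MinImage δ)
    (v w : List ℕ) : M.Tρ ρ (v ++ w) = (M.Tρ ρ v).trans ((M.next v).Tρ ρ w) := by
  simp only [Tρ]
  rw [T_append, rho_congr ρ (next_append M v w)]
  ext i
  simp

/-- The relabelled output of the empty word is the identity. [folklore] -/
theorem Tρ_nil (ρ : MinImage δ → Equiv.Perm (Fin (minRank δ))) (M : MinImage δ) :
    M.Tρ ρ [] = 1 := by
  simp only [Tρ]
  rw [T_nil, rho_congr ρ M.next_nil]
  ext i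
  simp

/-- **Reconstruction with the relabelled enumerations** (Prop. 2.5 for `T̄`): for `q' ∈ M`,
`δ(q', w) = (enum ≫ ρ)_{δ(M,w)}⁻¹ (T̄(M, w) ((enum ≫ ρ)_M q'))`. [cite: Mullner2017, Prop. 2.5] -/
theorem wordAct_eq_ρ (ρ : MinImage δ → Equiv.Perm (Fin (minRank δ))) (M : MinImage δ)
    (w : List ℕ) (x : ↥M.1) :
    wordAct δ w x = ((((M.next w).enum.trans (ρ (M.next w))).symm
      (M.Tρ ρ w ((M.enum.trans (ρ M)) x)) : ↥(M.next w).1) : σ) := by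
  rw [wordAct_eq M w x]
  exact congrArg Subtype.val (congrArg (M.next w).enum.symm (by simp [Tρ]))

/-! ## Relabelled path sets -/

/-- `Ḡ_{q q̄}(ℓ)` for the relabelled transducer. [cite: Mullner2017, §2.3] -/
def pathOutputsρ (k : ℕ) (ρ : MinImage δ → Equiv.Perm (Fin (minRank δ))) (M M' : MinImage δ)
    (c : ZMod (transducerPeriod k δ)) : Finset (Equiv.Perm (Fin (minRank δ))) := by
  classical
  exact univ.filter fun g => ∃ w : List ℕ, (∀ d ∈ w, d < k) ∧
    (w.length : ZMod (transducerPeriod k δ)) = c ∧ M.next w = M' ∧ M.Tρ ρ w = g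

/-- Membership in `Ḡ_{q q̄}(ℓ)`. [folklore] -/
theorem mem_pathOutputsρ {ρ : MinImage δ → Equiv.Perm (Fin (minRank δ))} {M M' : MinImage δ}
    {c : ZMod (transducerPeriod k δ)} {g : Equiv.Perm (Fin (minRank δ))} :
    g ∈ M.pathOutputsρ k ρ M' c ↔ ∃ w : List ℕ, (∀ d ∈ w, d < k) ∧
      (w.length : ZMod (transducerPeriod k δ)) = c ∧ M.next w = M' ∧ M.Tρ ρ w = g := by
  classical
  simp [pathOutputsρ]

/-- **Relabelled path sets are conjugates** (Prop. 2.6: `Ḡ_{q q̄}(ℓ) = σ_q G_{q q̄}(ℓ) σ_{q̄}⁻¹`):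
`g ∈ Ḡ_{M M'}(c) ↔ ρ_M ≫ g ≫ ρ_{M'}⁻¹ ∈ G_{M M'}(c)`. [cite: Mullner2017, Prop. 2.6] -/
theorem mem_pathOutputsρ_iff {ρ : MinImage δ → Equiv.Perm (Fin (minRank δ))} {M M' : MinImage δ}
    {c : ZMod (transducerPeriod k δ)} {g : Equiv.Perm (Fin (minRank δ))} :
    g ∈ M.pathOutputsρ k ρ M' c ↔ ((ρ M).trans g).trans (ρ M').symm ∈ M.pathOutputs k M' c := by
  rw [mem_pathOutputsρ, mem_pathOutputs]
  constructor
  · rintro ⟨w, hwd, hc, hnext, rfl⟩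
    refine ⟨w, hwd, hc, hnext, ?_⟩
    rw [Tρ, hnext]
    ext i
    simp
  · rintro ⟨w, hwd, hc, hnext, hT⟩
    refine ⟨w, hwd, hc, hnext, ?_⟩
    rw [Tρ, hnext, hT]
    ext i
    simp

/-- Products for the relabelled path sets (Lemma 2.11, ⊇). [cite: Mullner2017, Lemma 2.11] -/
theorem trans_mem_pathOutputsρ {ρ : MinImage δ → Equiv.Perm (Fin (minRank δ))}
    {M₁ M₂ M₃ : MinImage δ} {c₁ c₂ : ZMod (transducerPeriod k δ)}
    {g₁ g₂ : Equiv.Perm (Fin (minRank δ))} (h₁ : g₁ ∈ M₁.pathOutputsρ k ρ M₂ c₁)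
    (h₂ : g₂ ∈ M₂.pathOutputsρ k ρ M₃ c₂) : g₁.trans g₂ ∈ M₁.pathOutputsρ k ρ M₃ (c₁ + c₂) := by
  obtain ⟨w₁, hw₁d, hc₁, hn₁, rfl⟩ := mem_pathOutputsρ.1 h₁
  obtain ⟨w₂, hw₂d, hc₂, hn₂, rfl⟩ := mem_pathOutputsρ.1 h₂
  refine mem_pathOutputsρ.2 ⟨w₁ ++ w₂, digits_append hw₁d hw₂d, ?_, ?_, ?_⟩
  · rw [List.length_append, Nat.cast_add, hc₁, hc₂]
  · rw [next_append, hn₁, hn₂]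
  · rw [Tρ_append, hn₁]

/-- Inverses for the relabelled path sets. [cite: Mullner2017, Lemma 2.11 (proof)] -/
theorem symm_mem_pathOutputsρ (hk : 0 < k) (htriv : ∀ q d, k ≤ d → δ q d = q)
    {ρ : MinImage δ → Equiv.Perm (Fin (minRank δ))} {M M' : MinImage δ}
    {c : ZMod (transducerPeriod k δ)} {g : Equiv.Perm (Fin (minRank δ))}
    (h : g ∈ M.pathOutputsρ k ρ M' c) : g.symm ∈ M'.pathOutputsρ k ρ M (-c) := by
  rw [mem_pathOutputsρ_iff] at h ⊢
  have := symm_mem_pathOutputs hk htriv h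
  convert this using 1
  ext i
  simp

/-- The relabelled path sets have the size of the old ones (conjugation is a bijection).
[cite: Mullner2017, Prop. 2.6] -/
theorem card_pathOutputsρ (ρ : MinImage δ → Equiv.Perm (Fin (minRank δ))) (M M' : MinImage δ)
    (c : ZMod (transducerPeriod k δ)) :
    (M.pathOutputsρ k ρ M' c).card = (M.pathOutputs k M' c).card := by
  have himage : M.pathOutputsρ k ρ M' c =
      (M.pathOutputs k M' c).image fun g => ((ρ M).symm.trans g).trans (ρ M') := by
    ext g
    rw [mem_pathOutputsρ_iff, mem_image]
    constructor
    · intro h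
      refine ⟨_, h, ?_⟩
      ext i; simp
    · rintro ⟨g', hg', rfl⟩
      convert hg' using 1
      ext i; simp
  rw [himage, card_image_of_injective]
  refine Function.LeftInverse.injective
    (g := fun g' : Equiv.Perm (Fin (minRank δ)) => ((ρ M).trans g').trans (ρ M').symm) fun a => ?_
  ext i
  simp

/-- All relabelled path sets have the same size. [cite: Mullner2017, Lemma 2.11] -/
theorem card_pathOutputsρ_eq (hk : 0 < k) (htriv : ∀ q d, k ≤ d → δ q d = q)
    (ρ : MinImage δ → Equiv.Perm (Fin (minRank δ)))
    (M M' M₀ N₀ : MinImage δ) (c c' : ZMod (transducerPeriod k δ)) :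
    (M.pathOutputsρ k ρ M' c).card = (M₀.pathOutputsρ k ρ N₀ c').card := by
  rw [card_pathOutputsρ, card_pathOutputsρ, card_pathOutputs_eq hk htriv M M' M₀ c,
    card_pathOutputs_eq hk htriv M₀ N₀ M₀ c']

/-- The relabelled loop group `Ḡ_q = Ḡ_{qq}(0)` (Cor. 2.12 for `T̄`). [cite: Mullner2017, Cor. 2.12] -/
def loopGroupρ (hk : 0 < k) (htriv : ∀ q d, k ≤ d → δ q d = q)
    (ρ : MinImage δ → Equiv.Perm (Fin (minRank δ))) (M : MinImage δ) :
    Subgroup (Equiv.Perm (Fin (minRank δ))) where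
  carrier := ↑(M.pathOutputsρ k ρ M 0)
  one_mem' := by
    rw [mem_coe]
    exact mem_pathOutputsρ.2 ⟨[], by simp, by simp, M.next_nil, M.Tρ_nil ρ⟩
  mul_mem' := by
    intro f g hf hg
    rw [mem_coe] at hf hg ⊢
    have := trans_mem_pathOutputsρ hg hf
    rwa [add_zero, ← Equiv.Perm.mul_def] at this
  inv_mem' := by
    intro g hg
    rw [mem_coe] at hg ⊢
    have := symm_mem_pathOutputsρ hk htriv hg
    rwa [neg_zero, ← Equiv.Perm.inv_def] at this

/-- Membership in `Ḡ_q`. [folklore] -/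
theorem mem_loopGroupρ {hk : 0 < k} {htriv : ∀ q d, k ≤ d → δ q d = q}
    {ρ : MinImage δ → Equiv.Perm (Fin (minRank δ))} {M : MinImage δ}
    {g : Equiv.Perm (Fin (minRank δ))} :
    g ∈ M.loopGroupρ hk htriv ρ ↔ g ∈ M.pathOutputsρ k ρ M 0 :=
  Iff.rfl

/-! ## Lemma 2.14: the good relabelling -/

/-- **Müllner 2017, Lemma 2.14: the good relabelling** at the base state `M₀`: `ρ_{M₀} = 1` and
`ρ_M ∈ G_{M M₀}(0)` otherwise (the inverse of Müllner's `σ_q ∈ G_{q₀ q}(0)`).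
[cite: Mullner2017, Lemma 2.14] -/
def goodLabel (hk : 0 < k) (htriv : ∀ q d, k ≤ d → δ q d = q) (M₀ : MinImage δ) :
    MinImage δ → Equiv.Perm (Fin (minRank δ)) :=
  fun M => if M = M₀ then 1 else (pathOutputs_nonempty hk htriv M M₀ 0).choose

/-- The good relabelling is trivial at the base state. [folklore] -/
theorem goodLabel_self (hk : 0 < k) (htriv : ∀ q d, k ≤ d → δ q d = q) (M₀ : MinImage δ) :
    goodLabel hk htriv M₀ M₀ = 1 := if_pos rfl

/-- The defining property: `ρ_M ∈ G_{M M₀}(0)` (also at `M = M₀`, where `1 ∈ G_{M₀M₀}(0)`).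
[cite: Mullner2017, Lemma 2.14] -/
theorem goodLabel_mem (hk : 0 < k) (htriv : ∀ q d, k ≤ d → δ q d = q) (M₀ M : MinImage δ) :
    goodLabel hk htriv M₀ M ∈ M.pathOutputs k M₀ 0 := by
  by_cases h : M = M₀
  · subst h
    rw [goodLabel_self]
    exact mem_pathOutputs.2 ⟨[], by simp, by simp, M.next_nil, M.T_nil⟩
  · rw [goodLabel, if_neg h]
    exact (pathOutputs_nonempty hk htriv M M₀ 0).choose_spec

/-- **Müllner 2017, Lemma 2.14**: with the good relabelling, `id ∈ Ḡ_{M₀ M}(0)` for every `M`.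
[cite: Mullner2017, Lemma 2.14] -/
theorem one_mem_pathOutputsρ_goodLabel (hk : 0 < k) (htriv : ∀ q d, k ≤ d → δ q d = q)
    (M₀ M : MinImage δ) :
    (1 : Equiv.Perm (Fin (minRank δ))) ∈ M₀.pathOutputsρ k (goodLabel hk htriv M₀) M 0 := by
  rw [mem_pathOutputsρ_iff, goodLabel_self]
  have h := symm_mem_pathOutputs hk htriv (goodLabel_mem hk htriv M₀ M)
  rw [neg_zero] at h
  convert h using 1
  ext i
  simp

/-! ## Prop. 2.15 (class 0) and Thm. 2.7 (1) -/

/-- A path set containing `Ḡ_{M₀M₀}(0)` equals it (all path sets have the same size). [folklore] -/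
theorem pathOutputsρ_eq_of_subset (hk : 0 < k) (htriv : ∀ q d, k ≤ d → δ q d = q)
    {ρ : MinImage δ → Equiv.Perm (Fin (minRank δ))}
    {M₀ M M' : MinImage δ} {c : ZMod (transducerPeriod k δ)}
    (h : M₀.pathOutputsρ k ρ M₀ 0 ⊆ M.pathOutputsρ k ρ M' c) :
    M.pathOutputsρ k ρ M' c = M₀.pathOutputsρ k ρ M₀ 0 :=
  (eq_of_subset_of_card_le h (card_pathOutputsρ_eq hk htriv ρ M M' M₀ M₀ c 0).le).symm

/-- `g ≫ 1 = g` in the form produced by `trans_mem_pathOutputsρ`. [folklore] -/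
theorem trans_one_eq (g : Equiv.Perm (Fin (minRank δ))) :
    g.trans (1 : Equiv.Perm (Fin (minRank δ))) = g := by
  rw [Equiv.Perm.one_def, Equiv.trans_refl]

/-- `1 ≫ g = g`. [folklore] -/
theorem one_trans_eq (g : Equiv.Perm (Fin (minRank δ))) :
    (1 : Equiv.Perm (Fin (minRank δ))).trans g = g := by
  rw [Equiv.Perm.one_def, Equiv.refl_trans]

/-- **Müllner 2017, Prop. 2.15, class `0`**: for a relabelling with `id ∈ Ḡ_{M₀ M}(0)` for all
`M` (Lemma 2.14), all the sets `Ḡ_{M M'}(0)` coincide with `Ḡ = Ḡ_{M₀ M₀}(0)` ("`G_{q q̄}(0) = G`").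
[cite: Mullner2017, Prop. 2.15] -/
theorem pathOutputsρ_zero_eq (hk : 0 < k) (htriv : ∀ q d, k ≤ d → δ q d = q)
    {ρ : MinImage δ → Equiv.Perm (Fin (minRank δ))} {M₀ : MinImage δ}
    (hρ : ∀ M, (1 : Equiv.Perm (Fin (minRank δ))) ∈ M₀.pathOutputsρ k ρ M 0) (M M' : MinImage δ) :
    M.pathOutputsρ k ρ M' 0 = M₀.pathOutputsρ k ρ M₀ 0 := by
  -- Step 1: `Ḡ_{X M₀}(0) = Ḡ` (it contains `id ≫ Ḡ`, `id ∈ Ḡ_{X M₀}(0)` by inversion).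
  have step1 : ∀ X : MinImage δ, X.pathOutputsρ k ρ M₀ 0 = M₀.pathOutputsρ k ρ M₀ 0 := by
    intro X
    refine pathOutputsρ_eq_of_subset hk htriv fun g hg => ?_
    have h1 : (1 : Equiv.Perm (Fin (minRank δ))) ∈ X.pathOutputsρ k ρ M₀ 0 := by
      have := symm_mem_pathOutputsρ hk htriv (hρ X)
      rwa [neg_zero, Equiv.Perm.one_def, Equiv.refl_symm, ← Equiv.Perm.one_def] at this
    have := trans_mem_pathOutputsρ h1 hg
    rwa [add_zero, one_trans_eq] at this
  -- Step 2: `Ḡ_{M M'}(0) ⊇ Ḡ_{M M₀}(0) ≫ id = Ḡ`.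
  refine pathOutputsρ_eq_of_subset hk htriv fun g hg => ?_
  rw [← step1 M] at hg
  have := trans_mem_pathOutputsρ hg (hρ M')
  rwa [add_zero, trans_one_eq] at this

/-- **Müllner 2017, Theorem 2.7 (1)**: for a relabelling as in Lemma 2.14, the output `T̄(M, w)`
of EVERY state `M` along EVERY word of length divisible by `d(A)` lies in the group
`Ḡ = Ḡ_{M₀M₀}(0)`. [cite: Mullner2017, Thm. 2.7] -/
theorem Tρ_mem_loopGroupρ (hk : 0 < k) (htriv : ∀ q d, k ≤ d → δ q d = q)
    {ρ : MinImage δ → Equiv.Perm (Fin (minRank δ))} {M₀ : MinImage δ}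
    (hρ : ∀ M, (1 : Equiv.Perm (Fin (minRank δ))) ∈ M₀.pathOutputsρ k ρ M 0) (M : MinImage δ)
    {w : List ℕ} (hwd : ∀ d ∈ w, d < k) (hw : transducerPeriod k δ ∣ w.length) :
    M.Tρ ρ w ∈ M₀.loopGroupρ hk htriv ρ := by
  rw [mem_loopGroupρ, ← pathOutputsρ_zero_eq hk htriv hρ M (M.next w)]
  exact mem_pathOutputsρ.2 ⟨w, hwd, (ZMod.natCast_eq_zero_iff _ _).2 hw, rfl, rfl⟩

/-- **Theorem 2.7 (1) with `d(A) = 1`** (the situation after Prop. 2.25): every output of the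
well-labelled transducer along a digit word lies in `Ḡ`. [cite: Mullner2017, Thm. 2.7] -/
theorem Tρ_mem_loopGroupρ_of_period_eq_one (hk : 0 < k) (htriv : ∀ q d, k ≤ d → δ q d = q)
    {ρ : MinImage δ → Equiv.Perm (Fin (minRank δ))} {M₀ : MinImage δ}
    (hρ : ∀ M, (1 : Equiv.Perm (Fin (minRank δ))) ∈ M₀.pathOutputsρ k ρ M 0)
    (hd : transducerPeriod k δ = 1) (M : MinImage δ) {w : List ℕ} (hwd : ∀ d ∈ w, d < k) :
    M.Tρ ρ w ∈ M₀.loopGroupρ hk htriv ρ :=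
  Tρ_mem_loopGroupρ hk htriv hρ M hwd (by rw [hd]; exact one_dvd _)

/-- **The good relabelling of Lemma 2.14 realises Thm. 2.7 (1)**: with `ρ = goodLabel M₀`,
`T̄(M, w) ∈ Ḡ` for every digit word with `d(A) ∣ |w|`. [cite: Mullner2017, Thm. 2.7] -/
theorem Tρ_goodLabel_mem (hk : 0 < k) (htriv : ∀ q d, k ≤ d → δ q d = q) (M₀ M : MinImage δ)
    {w : List ℕ} (hwd : ∀ d ∈ w, d < k) (hw : transducerPeriod k δ ∣ w.length) :
    M.Tρ (goodLabel hk htriv M₀) w ∈ M₀.loopGroupρ hk htriv (goodLabel hk htriv M₀) :=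
  Tρ_mem_loopGroupρ hk htriv (one_mem_pathOutputsρ_goodLabel hk htriv M₀) M hwd hw

end MinImage

end Literature.NumberTheory.LFunctions
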